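import Summits.ABC.IUTFork.Repair.RHHeightScalingR4Classes
import HarnessLib

/-!
# R-H ROUND 4, row R4XFER — the CROSS-`l` TRANSFER LAW `XferLaw C Λ l₀` (residual R-07× of census row O-07 (R3×); the same
# residual under O-11's widenings B1/B2): the HYPOTHETICAL object typed as a SPEC in cell currency, the door it would open, the
# bill it forgives, and the single-packet law of record it contradicts — DEF-ONLY

abc-iut cell, rung LADDER-ABC:A2.RESCUE.H; AUTHORED by seat abc-iut-rh3-gen-2 (planner, gen 10), KEY `wake/KEY-abc-iut-rh3-gen-2-R4XFER.md` (abc-iut-rh-lead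
g5 14:25:12Z; referee abc-iut-rh-ref-2 g12 13:58:48Z / 14:23:10Z «type the transfer law XferLaw that (R3×) needs»); scratch bytes 3701d3edd39a5eff FILED
UNCHANGED (this sentence apart) by the R4OBJ-TYPE typing lane abc-iut-rh2-T-1 (gen 6) at the author's HAND-OFF REQUEST (STATUS 2026-08-27T14:41:45Z;
planner seats do not self-file). SEQUEL BY NAME of abc-iut-rh2-T-1's
`Repair/RHHeightScaling.lean` (p532994: `DoorAt`, `NegExponent`, `ExponentAtMost`), `Repair/RHHeightScalingMultiL.lean` (p537489, abc-iut-rh2-q2-eq: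
`not_doorAt_pool` (R1)/(R2) no door; `doorAt_crossPool_of_count` + `crossPool_own_bill_le_div` — the (R3×) count door and its unpaid bills) and
`Repair/RHHeightScalingR4Classes.lean` (p538051 §0: `PlaceRay`, `totalDemand`, `totalPrice`, `requirement`, `stepProfile`, `Ray_ClosesFrom`; T-1's v2 §2
`multiLCross` / `MultiL_CrossPoolDoorShape` name `XferLaw` as «residual R-07×, NOT typed here» — this file types it). Nothing is restated; no theorem here
(the two census faces are kernel-checked in the sibling scratch `RHXferLawFaces.lean`, offered to abc-iut-rh2-w-2 R4OBJ-FACES).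

WHAT (R3×) NEEDS AND PRINT DOES NOT WRITE (memo of record `ROUND4/R4-6-MULTIL-rh2-q2-eq.md` v1.1 §1/§2(c)(d)). In the multi-`l` reformulation every
prime `l` of a curve datum `C` carries its OWN packet = its own height ray `C.ray l` (books `M_l(n)`, `Π_l(n)`, requirement `T_l(n) = M_l(n) − τ_l`).
Print's certificate for the `l₀` inequality is bounded by `l₀`'s OWN netting envelope `min(M_{l₀}, Π_{l₀})` ([IUTchIII] Cor. 3.12: the log-volume of
the holomorphic hull of the union of possible images of THE theta-pilot object of ONE initial Θ-datum, whose `l` is fixed by [IUTchI] Def. 3.1 (c),(f);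
cell: `Cor312Vol.logvol_possibleImage_eq`, every round-3 class `≤ Π` cell by cell, p532994 §2) — typed below as `OwnConeLaw`. The (R3×) functional
instead CREDITS the `l₀` inequality with the kept mass `min(M_l, Π_l)` of OTHER packets `l ≠ l₀`, discounted by a loss factor `Λ(l) ∈ [0,1]`, while
those packets' own requirements `T_l` go UNPAID (`crossPool_own_bill_le_div`: paying them returns exponent `−1`). `XferLaw C Λ l₀` is exactly that
licence, stated about a CREDIT COLUMN `C.cert l₀ n` (the mass a hypothetical multi-`l` object would certify on the credit side of the `l₀` inequality):
typed ≠ instantiated — NO object in print or in the tree is claimed to satisfy it, and `Xfer_ConeClash` records that none obeying print's own-cone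
law can, except with the NULL transfer.

TWO READINGS CARRIED, NONE PICKED (R-conventions): `Λ : ℕ → ℝ` is the per-prime LOSS FACTOR (height-free, as in the KEY's signature); WHICH primes
are pooled at height step `n` is the separate datum `C.src n` — reading (F) FIXED table primes (`C.src` constant: the q2-eq beds, 4–6 primes per curve),
reading (W) a WINDOW growing with the height (print-shaped: [IUTchIV] Cor. 2.2 (C1) `l ≥ max{√(h_{F_mod}+h_{S^bad_mod}), 5}`, p. 42; (P1) prime-number-
theorem window `[√h, 10δ·√h·log(2δh)]`, p. 45, one `l` CHOSEN per curve there — the count `N(s) ≍ √s` primes is what `Xfer_DoorShape` consumes).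

CONTENTS (namespace `Summit.ABC.IUTFork.Repair.RH.Xfer`; every IUT locution `[claim: Mochizuki2012, status: disputed]`; bookkeeping `[folklore]`):
* §1 `MultiLDatum` (packets `ray l`, source primes `src n`, credit column `cert l₀ n`), `keptMass`, `xferCredit` (the Λ-discounted source credit),
  `forgivenBill` (the Λ-weighted source requirements the licence leaves unpaid), `xferProfile` (credited fraction of `l₀`'s mass, D2 convention).
* §2 the laws: `XferLaw C Λ l₀` (THE RESIDUAL R-07×: loss factors in `[0,1]` and the credit column covers own kept mass + transfer credit, sources
  owing nothing), `OwnConeLaw C l₀` (print's law of record: credit ≤ own netting envelope), `XferClosesFrom C l₀ n₀` (the `l₀` requirement met by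
  the credit column), `XferDoor C Λ l₀` (p532994 `DoorAt` of the transfer profile).
* §3 statement shapes (Props, EXPECTED TRUE, for abc-iut-rh2-w-2; proved in scratch `RHXferLawFaces.lean`): `Xfer_ConeClash` (XferLaw ∧ OwnConeLaw
  ⇒ the transfer credit is `0` at every step — the KILLED-BY-CONSISTENCY face), `Xfer_ForgivenBillLinear` (with the round-3 price cap `kept_l ≤ ĉ·M_l(1)`,
  closing at step `n` by transfer forces the Λ-weighted source mass `Σ_{l ≠ l₀} Λ(l)·M_l(1) ≥ (n·M_{l₀}(1) − τ)/ĉ − M_{l₀}(1)` — the forgiven bill is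
  LINEAR in the height; the «minimal Λ-law» of the census word), `Xfer_DoorShape` (count `≥ n` sources each crediting `≥ π₀` ⇒ `XferDoor`; the
  Finset-indexed form of p537489 `doorAt_crossPool_of_count`).
HONEST FRAMING: real-number bookkeeping about OUR typed cell. `XferLaw` is a HYPOTHETICAL licence that no located sentence of [IUTchI–IV], Joshi ATS
III/IV, Scholze–Stix 2018 or Dupuy–Hilado I/II states (R4XFER memo `ROUND4/R4-6-XFER-rh3-gen-2.md` §2: locate-or-NULL table); typing it is not
evidence for it. Nothing here asserts that abc is proved or refuted, that [IUTchIII] Cor. 3.12 holds or fails at any datum, or takes a side on any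
author; typed ≠ proved; computed ≠ proved; located ≠ adjudicated. No new Literature facts, no instance, no notation, no sorry.
[cite: Mochizuki2012, IUTchI Def. 3.1 p. 61–62; IUTchIII Cor. 3.12 p. 173–174; IUTchIV Cor. 2.2 p. 42–45, Rmk. 2.2.4 (ii) p. 53]
-/

namespace Summit.ABC.IUTFork.Repair.RH.Xfer

open Finset
open Summit.ABC.IUTFork.Repair.RH.HeightScaling
open Summit.ABC.IUTFork.Repair.RH.HeightScalingR4Classes

variable {ι : Type}

/-! ## §1. Multi-`l` books of one curve datum and the transfer functional -/

/-- **MULTI-`l` BOOKS of ONE curve datum** (memo §1): `ray l` = the packet at the prime `l` read along the height ray (p538051 `PlaceRay`,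
instantiated by the class seats as `heightRay …` of the datum at `l`; its books are `totalDemand (ray l) n = M_l(n)`, `totalPrice (ray l) n = Π_l(n)`,
`requirement (ray l) n = T_l(n)`); `src n` = the primes POOLED at height step `n` (reading (F): constant = the table primes; reading (W): the print-
shaped window at height `n·h_C`); `cert l₀ n` = the CREDIT COLUMN: the mass (nats) a HYPOTHETICAL multi-`l` object certifies on the credit side of the
`l₀` inequality at step `n` — a free datum constrained only by the laws of §2 (print's object: `OwnConeLaw`; the (R3×) licence: `XferLaw`). No such
multi-`l` object is exhibited in print or in the tree. [claim: Mochizuki2012, status: disputed] -/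
@[claim "Mochizuki2012" "disputed"]
structure MultiLDatum (ι : Type) where
  /-- the packet at prime `l`, as a ray in the height step -/
  ray : ℕ → PlaceRay ι
  /-- the source primes pooled at height step `n` -/
  src : ℕ → Finset ℕ
  /-- `cert l₀ n`: certified credit-side mass for the `l₀` inequality at step `n` -/
  cert : ℕ → ℕ → ℝ

/-- **Kept mass of packet `l` at step `n`**: the netting envelope `min(M_l(n), Π_l(n))` (mass form of p538051 `nettingKept`; the summand of T-1's
`multiLCross`). [claim: Mochizuki2012, status: disputed] -/
@[claim "Mochizuki2012" "disputed"]
noncomputable def keptMass (C : MultiLDatum ι) (l n : ℕ) : ℝ :=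
  min (totalDemand (C.ray l) n) (totalPrice (C.ray l) n)

/-- **TRANSFER CREDIT** at step `n` toward the target prime `l₀`: `Σ_{l ∈ src(n), l ≠ l₀} Λ(l)·min(M_l(n), Π_l(n))` — the kept mass of every OTHER
pooled packet, discounted by the loss factor `Λ(l)` (memo §2(d): `Λ ≡ 1` = loss-free pooling = q2-eq's `multiLCross` numerator minus the own term).
[claim: Mochizuki2012, status: disputed] -/
@[claim "Mochizuki2012" "disputed"]
noncomputable def xferCredit (C : MultiLDatum ι) (Λ : ℕ → ℝ) (l₀ n : ℕ) : ℝ :=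
  ∑ l ∈ (C.src n).erase l₀, Λ l * keptMass C l n

/-- **FORGIVEN BILL** at step `n`: `Σ_{l ∈ src(n), l ≠ l₀} Λ(l)·T_l(n)` — the (Λ-weighted) OWN requirements of the source packets, which the transfer
licence leaves unpaid (p537489 `crossPool_own_bill_le_div`: charging them returns the pooled books to exponent `−1`). With `Λ ≡ 1` on the sources and
height rays this is q2-eq's unpaid-bill ratio `U·M_{l₀}(n)` minus the own term. [claim: Mochizuki2012, status: disputed] -/
@[claim "Mochizuki2012" "disputed"]
noncomputable def forgivenBill (C : MultiLDatum ι) (Λ : ℕ → ℝ) (l₀ n : ℕ) : ℝ :=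
  ∑ l ∈ (C.src n).erase l₀, Λ l * requirement (C.ray l) n

/-- **TRANSFER PROFILE** toward `l₀`: the credited fraction of `l₀`'s trivial mass, `(min(M_{l₀},Π_{l₀})(n) + xferCredit(n)) / M_{l₀}(n)` (D2
convention: fractions against the MASS; `M_{l₀}(n) = 0` gives the junk value — class seats keep `M > 0`). Reading (F) with `Λ ≡ 1`: exponent `−1`,
constant `ĉ_X = U·ĉ_R2` (memo §3); reading (W) with `N(n) ≥ n` sources: a door by count (`Xfer_DoorShape`). [claim: Mochizuki2012, status: disputed] -/
@[claim "Mochizuki2012" "disputed"]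
noncomputable def xferProfile (C : MultiLDatum ι) (Λ : ℕ → ℝ) (l₀ : ℕ) : ℕ → ℝ :=
  fun n => (keptMass C l₀ n + xferCredit C Λ l₀ n) / totalDemand (C.ray l₀) n

/-! ## §2. The laws: the transfer licence (residual R-07×), print's own-cone law, closing and door by transfer -/

/-- **`XferLaw C Λ l₀` — THE CROSS-`l` TRANSFER LAW (residual R-07× of census row O-07 (R3×); O-11 B1/B2 leave it unchanged).** Loss factors
`Λ(l) ∈ [0,1]` (a TRANSFER: no packet is credited with more than it keeps), and at every height step `n ≥ 1` the credit column of the `l₀` inequality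
covers `l₀`'s own kept mass PLUS the Λ-discounted kept mass of every other pooled packet — the sources' own requirements being nobody's charge
(`forgivenBill` is not debited anywhere: that omission IS the licence). This is the sentence (R3×) needs and print does not write: [IUTchIII] Cor. 3.12
bounds ONE Θ-pilot's `−|log(q)|` by the hull of ITS OWN possible images ([IUTchI] Def. 3.1: one `l` per initial Θ-datum); [IUTchIV] Cor. 2.2 (C1)/(P1)
CHOOSE one `l` per curve and never sum inequalities over `l`. HYPOTHETICAL; EXPECTED UNREALISABLE by any object obeying `OwnConeLaw` except with
`xferCredit = 0` (`Xfer_ConeClash`). [claim: Mochizuki2012, status: disputed] -/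
@[claim "Mochizuki2012" "disputed"]
def XferLaw (C : MultiLDatum ι) (Λ : ℕ → ℝ) (l₀ : ℕ) : Prop :=
  (∀ l : ℕ, 0 ≤ Λ l ∧ Λ l ≤ 1) ∧
    ∀ n : ℕ, 1 ≤ n → keptMass C l₀ n + xferCredit C Λ l₀ n ≤ C.cert l₀ n

/-- **`OwnConeLaw C l₀` — PRINT'S LAW OF RECORD in cell currency.** The credit side of the `l₀` inequality never exceeds `l₀`'s OWN netting envelope
`min(M_{l₀}(n), Π_{l₀}(n))`: every certificate the round-3/round-4 classes can write for the packet at `l₀` is a sub-quantity of the log-volume of the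
hull of that packet's own possible images (`Cor312Vol.logvol_possibleImage_eq`; p532994 §2 `covered_le_priceCap` / `RHHeightScalingDoor` §2: every
class `≤ Π` cell by cell; and trivially `≤ M`, the quantity being bounded). [claim: Mochizuki2012, status: disputed] -/
@[claim "Mochizuki2012" "disputed"]
def OwnConeLaw (C : MultiLDatum ι) (l₀ : ℕ) : Prop :=
  ∀ n : ℕ, 1 ≤ n → C.cert l₀ n ≤ keptMass C l₀ n

/-- **CLOSING BY TRANSFER from step `n₀`**: the `l₀` requirement `T_{l₀}(n) = M_{l₀}(n) − τ_{l₀}(n)` is met by the credit column at every `n ≥ n₀`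
(compare p538051 `Ray_ClosesFrom`, where the credit is the own envelope: kernel-false past the crossing `s× = Π/M`, p532994
`sum_demand_sub_price_pos_of_lt`). Under `XferLaw` this is what (R3×) would have to deliver at CONTENT heights `n ≥ s_T = τ/M_{l₀}(1)`; its price
is `Xfer_ForgivenBillLinear`. [claim: Mochizuki2012, status: disputed] -/
@[claim "Mochizuki2012" "disputed"]
def XferClosesFrom (C : MultiLDatum ι) (l₀ n₀ : ℕ) : Prop :=
  ∀ n : ℕ, n₀ ≤ n → requirement (C.ray l₀) n ≤ C.cert l₀ n

/-- **DOOR BY TRANSFER**: the transfer profile toward `l₀` stays above a positive constant along the ray (p532994 `DoorAt` read through p538051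
`stepProfile`) — the door (R3×) opens BY COUNT under reading (W) (`Xfer_DoorShape`; q2-eq: `f×_∞ = c·κ/24 > 0` iff `N(s) ≥ κ·s`, constant NOT
bed-witnessed: the fixed-prime beds plateau then decay, dense block `f× ≈ 1.2–5.1` on `s ≤ 256`). A door is NECESSARY, not sufficient, for closing
(abc-iut-rh3-tst-2). [claim: Mochizuki2012, status: disputed] -/
@[claim "Mochizuki2012" "disputed"]
def XferDoor (C : MultiLDatum ι) (Λ : ℕ → ℝ) (l₀ : ℕ) : Prop :=
  DoorAt (stepProfile (xferProfile C Λ l₀))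

/-! ## §3. Statement shapes for the faces seat (EXPECTED TRUE; kernel-checked in scratch `RHXferLawFaces.lean`) -/

/-- **CONE CLASH (the KILLED-BY-CONSISTENCY face).** If the credit column obeys BOTH the transfer licence `XferLaw C Λ l₀` and print's own-cone law
`OwnConeLaw C l₀`, and kept masses are non-negative (true on every bed: `M, Π ≥ 0`), then the transfer credit VANISHES at every step `n ≥ 1`: the only
transfer compatible with the single-packet law of record is the NULL transfer (every pooled source has `Λ(l)·min(M_l,Π_l) = 0`). EXPECTED TRUE (three
lines: `0 ≤ xferCredit ≤ cert − kept ≤ 0`). [claim: Mochizuki2012, status: disputed] -/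
@[claim "Mochizuki2012" "disputed"]
def Xfer_ConeClash : Prop :=
  ∀ (ι : Type) (C : MultiLDatum ι) (Λ : ℕ → ℝ) (l₀ : ℕ),
    (∀ l n : ℕ, 0 ≤ keptMass C l n) → XferLaw C Λ l₀ → OwnConeLaw C l₀ →
      ∀ n : ℕ, 1 ≤ n → xferCredit C Λ l₀ n = 0

/-- **THE FORGIVEN BILL IS LINEAR IN THE HEIGHT (the minimal Λ-law).** Along height rays with base masses `B(l) = M_l(1) ≥ 0` and the round-3 price
cap `min(M_l(n), Π_l(n)) ≤ ĉ·B(l)` (`ĉ > 0`; beds: `ĉ = c_hi ∈ [1.6, 4.4]`, q2-eq per-l tables), if the transfer CLOSES the `l₀` requirement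
`n·B(l₀) − τ` at step `n` with loss factors `Λ ≥ 0`, then the Λ-weighted source base mass satisfies
`Σ_{l ∈ src(n), l ≠ l₀} Λ(l)·B(l) ≥ (n·B(l₀) − τ)/ĉ − B(l₀)`: past the content threshold `s_T = τ/B(l₀)` the pooled-and-forgiven source mass must grow
LINEARLY in the height (beds: `s_T ≈ 10⁵–10⁷`, so ≈ `s_T/ĉ` target-masses' worth of source packets, each with its own bill unpaid — memo
`R4-6-XFER-rh3-gen-2.md` §3). EXPECTED TRUE (sum comparison). [claim: Mochizuki2012, status: disputed] -/
@[claim "Mochizuki2012" "disputed"]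
def Xfer_ForgivenBillLinear : Prop :=
  ∀ (ι : Type) (C : MultiLDatum ι) (Λ : ℕ → ℝ) (l₀ n : ℕ) (B : ℕ → ℝ) (chat τ : ℝ),
    0 < chat → (∀ l : ℕ, 0 ≤ Λ l) → (∀ l : ℕ, 0 ≤ B l) → (∀ l : ℕ, keptMass C l n ≤ chat * B l) →
      (n : ℝ) * B l₀ - τ ≤ keptMass C l₀ n + xferCredit C Λ l₀ n →
        ((n : ℝ) * B l₀ - τ) / chat - B l₀ ≤ ∑ l ∈ (C.src n).erase l₀, Λ l * B l

/-- **DOOR SHAPE BY COUNT** (Finset-indexed form of p537489 `doorAt_crossPool_of_count` / T-1 v2 `MultiL_CrossPoolDoorShape`): if at every step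
`n ≥ 1` at least `n` pooled sources `l ≠ l₀` each credit `Λ(l)·min(M_l,Π_l)(n) ≥ π₀ > 0`, the own kept mass is `≥ 0`, and the target mass satisfies
`0 < M_{l₀}(n) ≤ n·M₀`, then `XferDoor C Λ l₀` with door constant `≥ π₀/M₀`. Reading (W) only: the count `N(n) ≥ n` is the (P1)-window census
(`≈ √s` primes CHOSEN FROM in print, here ALL pooled); reading (F) has `N` constant and no door (exponent `−1`). EXPECTED TRUE.
[claim: Mochizuki2012, status: disputed] -/
@[claim "Mochizuki2012" "disputed"]
def Xfer_DoorShape : Prop :=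
  ∀ (ι : Type) (C : MultiLDatum ι) (Λ : ℕ → ℝ) (l₀ : ℕ) (π₀ M₀ : ℝ),
    0 < π₀ → 0 < M₀ → (∀ n : ℕ, 0 ≤ keptMass C l₀ n) →
      (∀ n : ℕ, 1 ≤ n → (n : ℝ) ≤ (((C.src n).erase l₀).card : ℝ)) →
      (∀ n : ℕ, 1 ≤ n → ∀ l ∈ (C.src n).erase l₀, π₀ ≤ Λ l * keptMass C l n) →
      (∀ n : ℕ, 1 ≤ n → 0 < totalDemand (C.ray l₀) n ∧ totalDemand (C.ray l₀) n ≤ (n : ℝ) * M₀) →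
        XferDoor C Λ l₀

end Summit.ABC.IUTFork.Repair.RH.Xfer
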